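import Summits.BirchSwinnertonDyer.BirchSwinnertonDyer.Theorems.ManinLocalTwoThreeKummerCubeRootAnalyticDictionary
import Summits.BirchSwinnertonDyer.BirchSwinnertonDyer.Theorems.ManinLocalTwoThreeKummerCubeSigmaMonodromyPrelims
import HarnessLib

/-!
# Prelims for (AN2-b): `t_s · W_u` as an analytic germ in `w` at `0`, and `q → 0` bookkeeping
(route `ManinLocalTwoThree`, crux C3 `ManinPrimeToThreeAtNine` stmt-BirchSwinnertonDyer-22968; cell bsd-f2-manin, p2 gen 17;
`--supports stmt-BirchSwinnertonDyer-22968`; consumed by `…Theorems.ManinLocalTwoThreeKummerCubeRootSigmaIdentification`)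

For the identification of the holomorphic cube root `R(𝕢₁τ)` of `Θ̂_T` (p2's `KummerCubeRootDictionary`, p727203) with the `σ`-expression
`κ · t_s(τ) · W_u(c·E_f(τ))` of an's σ-monodromy line, one needs `t_s · W_u` as an ANALYTIC germ in `w = c·E_f(τ)` at `w = 0` (the cusp):
`t_s·W_u(w) = −2·P₂(w)·e^{ew/3}·σ(w − u) / (c·P₃(w))` with the ENTIRE `P₂ = σ′² − σσ″ = ℘σ²`, `P₃ = σP₂′ − 2σ′P₂ = ℘′σ³` of an's S4 prelims,
here re-built EXPLICITLY so that `P₂(0) = 1`, `P₃(0) = −2` (from `σ(0) = 0`, `σ′(0) = 1`).  PROVED (no sorry, no definition):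
`hasDerivAt_weierstrassSigma_zero` (`σ′(0) = 1`), `exists_entire_weierstrassP_sigma_values` (P₂, P₃ with their values at `0`),
`exists_analytic_shortT_mul_sigmaCubeRoot` (∃ Φ analytic at `0`, `Φ(0) = σ(−u)/c ≠ 0`, and `t_s(τ)·W_u(w(τ)) = Φ(w(τ))` whenever `w(τ) ∉ Λ`,
`P₃(w(τ)) ≠ 0`), `eventually_eichlerIntegral_smul_notMem` (for `q → 0`, `q ≠ 0`: `c·ε(q) ∉ Λ` and `P₃(c·ε(q)) ≠ 0`),
`eventually_nhdsWithin_of_forall_im_gt` (a statement for all `Im τ > B` is a punctured-neighbourhood statement in `q`; converse of an's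
`exists_im_bound_of_eventually`).  BSD is not proved by this; Manin's conjecture is not proved; C2/C3 OPEN. [folklore]
-/

set_option autoImplicit false
-- lint-debt: the directory name repeats the summit name (sibling precedent `ManinLocalTwoThreeKummerCubeSigmaMonodromyPrelims.lean`)
set_option linter.dupNamespace false

noncomputable section

open scoped Topology PeriodPair
open Complex Filter PowerSeries
open Literature.NumberTheory.EllipticCurves Literature.NumberTheory.EllipticCurves.ModularForms
open Summit.BirchSwinnertonDyer.Rank1Residual.ManinAdditive.CuspidalKummer
open Summit.BirchSwinnertonDyer.Rank1Residual.ManinAdditive.CuspidalKummerThree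
open Summit.BirchSwinnertonDyer.Rank1Residual.ManinAdditive.KummerCubeMonodromy
open Summit.BirchSwinnertonDyer.BirchSwinnertonDyer.Theorems.ManinLocalTwoThree.KummerCubeAnalytic

namespace Summit.BirchSwinnertonDyer.BirchSwinnertonDyer.Theorems.ManinLocalTwoThree.KummerCubeRootDictionary

/-! ### §1 `σ(0) = 0`, `σ′(0) = 1` -/

/-- `σ(0) = 0`. [folklore] -/
theorem weierstrassSigma_zero (L : PeriodPair) : L.weierstrassSigma 0 = 0 := by
  rw [PeriodPair.weierstrassSigma, zero_mul]

/-- `σ′(0) = 1`: `σ(z) = z·∏(…)` with every factor `= 1` at `z = 0`. [folklore] -/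
theorem hasDerivAt_weierstrassSigma_zero (L : PeriodPair) : HasDerivAt L.weierstrassSigma 1 0 := by
  have hT : Differentiable ℂ fun z : ℂ => ∏' l : L.lattice, PeriodPair.sigmaFactor z l :=
    L.differentiable_tprod_sigmaFactor
  have hT0 : (∏' l : L.lattice, PeriodPair.sigmaFactor (0 : ℂ) l) = 1 := by
    have : (fun l : L.lattice => PeriodPair.sigmaFactor (0 : ℂ) l) = fun _ => 1 := by
      funext l; simp [PeriodPair.sigmaFactor]
    rw [this, tprod_one]
  have h := (hasDerivAt_id (0 : ℂ)).mul (hT 0).hasDerivAt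
  simp only [id, zero_mul, add_zero, one_mul, hT0] at h
  exact h

/-! ### §2 The entire `P₂ = ℘σ²`, `P₃ = ℘′σ³` with their values at `0` -/

/-- **`℘σ²` and `℘′σ³` are entire, with `P₂(0) = 1`, `P₃(0) = −2`** (`P₂ = σ′² − σσ″`, `P₃ = σP₂′ − 2σ′P₂`; an's S4 prelims construction,
plus the values at `0` from `σ(0) = 0`, `σ′(0) = 1`). [folklore] -/
theorem exists_entire_weierstrassP_sigma_values (L : PeriodPair) :
    ∃ P₂ P₃ : ℂ → ℂ, Differentiable ℂ P₂ ∧ Differentiable ℂ P₃ ∧ P₂ 0 = 1 ∧ P₃ 0 = -2 ∧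
      (∀ w, w ∉ L.lattice → P₂ w = ℘[L] w * L.weierstrassSigma w ^ 2) ∧
      (∀ w, w ∉ L.lattice → P₃ w = ℘'[L] w * L.weierstrassSigma w ^ 3) := by
  have hσ : Differentiable ℂ L.weierstrassSigma := L.differentiable_weierstrassSigma_holds
  have hσ' : Differentiable ℂ (deriv L.weierstrassSigma) := fun z ↦
    ((hσ.analyticAt z).deriv).differentiableAt
  have hσ'' : Differentiable ℂ (deriv (deriv L.weierstrassSigma)) := fun z ↦
    ((hσ.analyticAt z).deriv.deriv).differentiableAt
  have hopen : IsOpen ((L.lattice : Set ℂ)ᶜ) := L.isClosed_lattice.isOpen_compl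
  have hσne : ∀ w, w ∉ L.lattice → L.weierstrassSigma w ≠ 0 := fun w hw h ↦
    hw ((L.weierstrassSigma_eq_zero_iff_holds w).mp h)
  obtain ⟨P₂, hP₂def⟩ : ∃ P₂ : ℂ → ℂ, P₂ = fun w ↦
      deriv L.weierstrassSigma w ^ 2 - L.weierstrassSigma w * deriv (deriv L.weierstrassSigma) w := ⟨_, rfl⟩
  have hP₂ : Differentiable ℂ P₂ := by rw [hP₂def]; exact (hσ'.pow 2).sub (hσ.mul hσ'')
  have hP₂' : Differentiable ℂ (deriv P₂) := fun z ↦ ((hP₂.analyticAt z).deriv).differentiableAt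
  have hP₂eq : ∀ w, w ∉ L.lattice → P₂ w = ℘[L] w * L.weierstrassSigma w ^ 2 := by
    intro w hw
    have hne := hσne w hw
    have hζ : L.weierstrassZeta =ᶠ[𝓝 w] fun u ↦ deriv L.weierstrassSigma u / L.weierstrassSigma u := by
      filter_upwards [hopen.mem_nhds hw] with u hu
      have := L.logDeriv_weierstrassSigma_holds u hu
      rw [logDeriv_apply] at this
      exact this.symm
    have h℘ : ℘[L] w = -deriv L.weierstrassZeta w := by
      rw [L.deriv_weierstrassZeta_holds w hw, neg_neg]
    have hquot : HasDerivAt (fun u ↦ deriv L.weierstrassSigma u / L.weierstrassSigma u)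
        ((deriv (deriv L.weierstrassSigma) w * L.weierstrassSigma w -
          deriv L.weierstrassSigma w * deriv L.weierstrassSigma w) / L.weierstrassSigma w ^ 2) w :=
      (hσ' w).hasDerivAt.div (hσ w).hasDerivAt hne
    rw [h℘, hζ.deriv_eq, hquot.deriv, hP₂def]
    field_simp
    ring
  obtain ⟨P₃, hP₃def⟩ : ∃ P₃ : ℂ → ℂ, P₃ = fun w ↦
      L.weierstrassSigma w * deriv P₂ w - 2 * deriv L.weierstrassSigma w * P₂ w := ⟨_, rfl⟩
  have hP₃ : Differentiable ℂ P₃ := by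
    rw [hP₃def]; exact (hσ.mul hP₂').sub ((hσ'.const_mul 2).mul hP₂)
  have hσ0 : L.weierstrassSigma 0 = 0 := weierstrassSigma_zero L
  have hσ'0 : deriv L.weierstrassSigma 0 = 1 := (hasDerivAt_weierstrassSigma_zero L).deriv
  have hP₂0 : P₂ 0 = 1 := by rw [hP₂def]; simp [hσ0, hσ'0]
  have hP₃0 : P₃ 0 = -2 := by rw [hP₃def]; norm_num [hσ0, hσ'0, hP₂0]
  refine ⟨P₂, P₃, hP₂, hP₃, hP₂0, hP₃0, hP₂eq, fun w hw ↦ ?_⟩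
  have heq : P₂ =ᶠ[𝓝 w] fun u ↦ ℘[L] u * L.weierstrassSigma u ^ 2 := by
    filter_upwards [hopen.mem_nhds hw] with u hu using hP₂eq u hu
  have hd : HasDerivAt (fun u ↦ ℘[L] u * L.weierstrassSigma u ^ 2)
      (℘'[L] w * L.weierstrassSigma w ^ 2 +
        ℘[L] w * ((2 : ℕ) * L.weierstrassSigma w ^ (2 - 1) * deriv L.weierstrassSigma w)) w :=
    (L.hasDerivAt_weierstrassP hw).mul ((hσ w).hasDerivAt.pow 2)
  rw [hP₃def]
  simp only
  rw [heq.deriv_eq, hd.deriv, hP₂eq w hw]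
  push_cast
  ring

/-! ### §3 `t_s·W_u` is an analytic germ in `w` at `0` -/

/-- **`t_s · W_u = Φ(w)` with `Φ` analytic at `w = 0`, `Φ(0) = σ(−u)/c ≠ 0`**: `Φ(w) = −2P₂(w)e^{ew/3}σ(w − u)/(c·P₃(w))`; the identity holds for
`w ∉ Λ` with `P₃(w) ≠ 0` (then `℘′(w) = P₃/σ³ ≠ 0` and all divisions are genuine).  Returned together with `P₃` (entire, `P₃(0) = −2`) so that the
side condition can be checked at `q → 0`. [folklore] -/
theorem exists_analytic_shortT_mul_sigmaCubeRoot
    {W : WeierstrassCurve ℚ} [W.IsElliptic] {N : ℕ} [NeZero N] (D : ModularParametrizationData W N) (hc0 : D.c ≠ 0)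
    {u : ℂ} (hu : u ∉ D.L.lattice) (e : ℂ) :
    ∃ Φ P₃ : ℂ → ℂ, AnalyticAt ℂ Φ 0 ∧ Φ 0 ≠ 0 ∧ Differentiable ℂ P₃ ∧ P₃ 0 = -2 ∧
      ∀ τ : UpperHalfPlane, (D.c : ℂ) * eichlerIntegral D.f τ ∉ D.L.lattice → P₃ ((D.c : ℂ) * eichlerIntegral D.f τ) ≠ 0 →
        shortT D τ * sigmaCubeRoot D.L u e ((D.c : ℂ) * eichlerIntegral D.f τ) = Φ ((D.c : ℂ) * eichlerIntegral D.f τ) := by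
  obtain ⟨P₂, P₃, hP₂, hP₃, hP₂0, hP₃0, hP₂eq, hP₃eq⟩ := exists_entire_weierstrassP_sigma_values D.L
  have hσ : Differentiable ℂ D.L.weierstrassSigma := D.L.differentiable_weierstrassSigma_holds
  have hc : (D.c : ℂ) ≠ 0 := Int.cast_ne_zero.mpr hc0
  have hσu : D.L.weierstrassSigma (0 - u) ≠ 0 := by
    rw [zero_sub]
    intro h
    exact hu (by simpa using D.L.lattice.neg_mem ((D.L.weierstrassSigma_eq_zero_iff_holds (-u)).mp h))
  refine ⟨fun w => -2 * P₂ w * cexp (e * w / 3) * D.L.weierstrassSigma (w - u) / ((D.c : ℂ) * P₃ w), P₃, ?_, ?_, hP₃, hP₃0, ?_⟩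
  · -- analytic at `0`: entire numerator, denominator `c·P₃` with `P₃(0) = −2 ≠ 0`
    have hnum : AnalyticAt ℂ (fun w => -2 * P₂ w * cexp (e * w / 3) * D.L.weierstrassSigma (w - u)) 0 := by
      refine ((analyticAt_const.mul (hP₂.analyticAt 0)).mul ?_).mul ?_
      · exact ((analyticAt_const.mul analyticAt_id).div_const).cexp'
      · exact ((hσ.comp (differentiable_id.sub_const u)).analyticAt 0)
    have hden : AnalyticAt ℂ (fun w => (D.c : ℂ) * P₃ w) 0 := analyticAt_const.mul (hP₃.analyticAt 0)
    exact hnum.div hden (by simp [hP₃0, hc])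
  · simp only [mul_zero, zero_div, Complex.exp_zero, mul_one, hP₂0, hP₃0]
    exact div_ne_zero (mul_ne_zero (by norm_num) hσu) (mul_ne_zero hc (by norm_num))
  · intro τ hw hP₃w
    set w : ℂ := (D.c : ℂ) * eichlerIntegral D.f τ with hw_def
    have hσw : D.L.weierstrassSigma w ≠ 0 := fun h => hw ((D.L.weierstrassSigma_eq_zero_iff_holds w).mp h)
    have h℘ : ℘[D.L] w = P₂ w / D.L.weierstrassSigma w ^ 2 := by
      rw [hP₂eq w hw]; field_simp
    have h℘' : ℘'[D.L] w = P₃ w / D.L.weierstrassSigma w ^ 3 := by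
      rw [hP₃eq w hw]; field_simp
    rw [shortT, shortX, shortY, sigmaCubeRoot, ← hw_def, h℘, h℘']
    field_simp

/-! ### §4 `q → 0` bookkeeping -/

/-- For `q → 0`, `q ≠ 0`: `w(q) = c·ε(q)` is NOT a lattice point and `P(w(q)) ≠ 0` for any `P` continuous at `0` with `P(0) ≠ 0`
(`ε = qGerm f`, `ε(0) = 0`, `ε(q) ≠ 0` near `0` for a normalised form, `Λ` discrete). [folklore] -/
theorem eventually_smul_qGerm_notMem {M : ℕ} [NeZero M] (f : CuspForm (CongruenceSubgroup.Gamma0 M) 2) (hf1 : cuspCoeff f 1 = 1)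
    (L : PeriodPair) {c : ℂ} (hc : c ≠ 0) {P : ℂ → ℂ} (hP : ContinuousAt P 0) (hP0 : P 0 ≠ 0) :
    ∀ᶠ q in 𝓝[≠] (0 : ℂ), c * qGerm f q ∉ L.lattice ∧ P (c * qGerm f q) ≠ 0 := by
  have hε : ContinuousAt (fun q => c * qGerm f q) 0 := (analyticAt_const.mul (analyticAt_qGerm f)).continuousAt
  have hε0 : c * qGerm f 0 = 0 := by rw [qGerm_zero, mul_zero]
  -- `w(q) ∈ (Λ \ {0})ᶜ` near `0`
  have h1 : ∀ᶠ q in 𝓝 (0 : ℂ), c * qGerm f q ∈ ((L.lattice : Set ℂ) \ {0})ᶜ := by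
    have h : ((L.lattice : Set ℂ) \ {0})ᶜ ∈ 𝓝 (c * qGerm f 0) := by
      rw [hε0]; exact L.compl_lattice_sdiff_singleton_mem_nhds 0
    exact hε.preimage_mem_nhds h
  -- `P(w(q)) ≠ 0` near `0`
  have h2 : ∀ᶠ q in 𝓝 (0 : ℂ), P (c * qGerm f q) ≠ 0 := by
    have hPc : ContinuousAt (fun q => P (c * qGerm f q)) 0 := by
      have hP' : ContinuousAt P (c * qGerm f 0) := by rw [hε0]; exact hP
      exact ContinuousAt.comp (f := fun q => c * qGerm f q) hP' hε
    have : P (c * qGerm f 0) ≠ 0 := by rw [hε0]; exact hP0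
    exact hPc.eventually_ne this
  -- `ε(q) ≠ 0` on the punctured neighbourhood (`ε(q) ∉ Λ ∋ 0`)
  have h3 : ∀ᶠ q in 𝓝[≠] (0 : ℂ), qGerm f q ≠ 0 := by
    filter_upwards [eventually_qGerm_notMem f hf1 L] with q hq h0
    exact hq (by rw [h0]; exact L.lattice.zero_mem)
  filter_upwards [h3, (h1.and h2).filter_mono nhdsWithin_le_nhds] with q hq3 hq12
  refine ⟨fun hmem => hq12.1 ⟨hmem, ?_⟩, hq12.2⟩
  rw [Set.mem_singleton_iff]
  exact mul_ne_zero hc hq3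

/-- **A statement for all `Im τ > B` is a punctured-neighbourhood statement in `q`** (every `q` with `0 < ‖q‖ < e^{−2πB}`, `‖q‖ < 1`, is
`𝕢₁(τ)` for `τ = invQParam q ∈ ℍ`; converse of an's `exists_im_bound_of_eventually`). [folklore] -/
theorem eventually_nhdsWithin_of_forall_im_gt {P : ℂ → Prop} {B : ℝ}
    (h : ∀ τ : UpperHalfPlane, B < τ.im → P (Function.Periodic.qParam 1 (τ : ℂ))) :
    ∀ᶠ q in 𝓝[≠] (0 : ℂ), P q := by
  set r : ℝ := min (Real.exp (-2 * Real.pi * B)) 1 with hr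
  have hr0 : 0 < r := lt_min (Real.exp_pos _) one_pos
  have hball : ∀ q : ℂ, q ≠ 0 → ‖q‖ < r → P q := by
    intro q hq0 hqr
    have hq1 : ‖q‖ < 1 := hqr.trans_le (min_le_right _ _)
    have hqB : ‖q‖ < Real.exp (-2 * Real.pi * B) := hqr.trans_le (min_le_left _ _)
    have him : 0 < (Function.Periodic.invQParam (1 : ℝ) q).im :=
      Function.Periodic.im_invQParam_pos_of_norm_lt_one (by norm_num) hq1 hq0
    set τ : UpperHalfPlane := ⟨Function.Periodic.invQParam (1 : ℝ) q, him⟩ with hτ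
    have hqτ : Function.Periodic.qParam 1 ((τ : UpperHalfPlane) : ℂ) = q := by
      show Function.Periodic.qParam 1 (Function.Periodic.invQParam (1 : ℝ) q) = q
      exact Function.Periodic.qParam_right_inv (by norm_num) hq0
    have hBτ : B < τ.im := by
      have hnorm := Function.Periodic.norm_qParam (h := (1 : ℝ)) ((τ : UpperHalfPlane) : ℂ)
      rw [hqτ] at hnorm
      -- `‖q‖ = e^{-2π Im τ} < e^{-2πB}`
      rw [hnorm, div_one] at hqB
      have h' := Real.exp_lt_exp.mp hqB
      have hτim : ((τ : UpperHalfPlane) : ℂ).im = τ.im := rfl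
      rw [hτim] at h'
      nlinarith [Real.pi_pos]
    rw [← hqτ]
    exact h τ hBτ
  rw [eventually_nhdsWithin_iff, Metric.eventually_nhds_iff]
  exact ⟨r, hr0, fun q hq hq0 => hball q hq0 (by rwa [dist_zero_right] at hq)⟩

end Summit.BirchSwinnertonDyer.BirchSwinnertonDyer.Theorems.ManinLocalTwoThree.KummerCubeRootDictionary

end
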